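import Summits.BirchSwinnertonDyer.BirchSwinnertonDyer.Theorems.SchneiderFreeAdditiveX3LocalTowerTorsionLineClauses
import Summits.BirchSwinnertonDyer.Rank1Residual.X2.GreenbergVatsalTateDatumSign
import Summits.BirchSwinnertonDyer.Rank1Residual.X2.GreenbergVatsalTateDatumCofree
import Literature.NumberTheory.GaloisRepresentations.LocalKroneckerWeberInertiaProofs
import HarnessLib

/-!
# The Tate line WITH ITS CHARACTER at every level, over a number field
# (crux `LocalTowerTorsionFiniteX3`, stmt-BirchSwinnertonDyer-19546, (M) cell — first file)

Seat `bsd-schneider-door-c2` (cell `bsd-schneider-ideate`), gen 5; route `SchneiderFreeAdditiveX3`.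
Hypothesis (ii) «the canonical line with its character» of door-c5's conditional stubs
`stub_finV_potMult_of_lineCharacter` / `stub_finV_gordTwo_of_lineCharacter`
(`…LocalTowerTorsionFiniteOfLine`) asks, on the (M) cell, for the TATE LINE `C ≅ μ_{p^∞}` of the
multiplicative `p*`-twist model read at `(K, 𝔭)` together with its CHARACTER: every `σ ∈ Γ_{K_𝔭}`
acts on `C[p^k]` by `± χ_p(σ)` (`a = p + 1`, `α = 1`).  The tree has the Tate datum for a number
field `K` (X2 `GreenbergVatsalTateDatum.tateDatum`, `…Sign.smul_sub_sign_smul_mem`,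
`…Cofree.tateDatum_plus_divisible / natCard_tateDatum_plus_inf_torsionBy`) but its CHARACTER only at
level one, on inertia, over `ℚ` (`GreenbergVatsalTateDatumTorsion.smul_eq_nsmul_of_cyclotomicCharacter_eq`).
This file supplies the all-level, all-`σ` character over any number field `K`, for a Tate
parametrisation `Ψ : K̄_v^* → E(K̄_v)` with kernel `q^ℤ`, `0 < |q|_v < 1`, twisted-equivariant through
`χ(σ) = σ(t)/t` (the shape of the named fact `Silverman1994_thmV53_corV54_tateUniformisation`, A41):

* §1 `exists_pow_eq_one_of_mem_tateDatum` — a point of `C` killed by `p^k` is `Ψ(ζ)`, `ζ ∈ μ_{p^k}`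
  (`ζ^{p^k} ∈ q^ℤ` of finite order is `1`);
* §2 `smul_eq_sign_mul_cyclotomic_smul_of_mem_tateDatum` — **the character**: for every
  `σ ∈ Γ_{K_v}` and `c ∈ C[p^k]`, `res σ • c = (χ(σ) · χ_p(σ) mod p^k) • c` (Mathlib's
  `cyclotomicCharacter.spec` through the tree's `GaloisRep.cyclotomicCharacter_spec`);
* §3 `tateDatum_lineCharacter_local` / `tateDatum_lineCharacter` — the same in the shape of
  hypothesis (ii) (`∃ s = ±1, ∀ k c N, N ≡ s·χ_p (mod p^k) → res σ • c = N • c`), with the LOCAL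
  cyclotomic character of `K_v` resp. the GLOBAL one of `K` at `res σ`
  (`cyclotomicCharacter_absGaloisRestrict`);
* §4 `tateDatum_plus_ne_bot` / `tateDatum_plus_ne_top` — the Tate line is non-zero and proper
  (`#C[p] = p` against `#E[p] = p²`), so door-c5's `lineClauses_of_divisible` applies.

Greenberg–Vatsal p. 14: "`C ≅ μ_{p^∞}` … (twisted by an unramified quadratic character in the
non-split case)".  Proofs only (no definition, no named fact, no `sorry`); the parametrisation is
explicit DATA here (the consumer file instantiates it from A41).  Helper for
stmt-BirchSwinnertonDyer-19546; closes nothing by itself; BSD is not advanced.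

References: [GreenbergVatsal2000] §2 pp. 14–15; [SilvermanATAEC1994] Ch. V Thm. 3.1 (c),(d), Lemma 5.2
(c), Thm. 5.3, Cor. 5.4; [SerreAbelianLadic1968] Ch. I §1.2 (cyclotomic character).
-/

noncomputable section

open scoped Classical

namespace Summit.BirchSwinnertonDyer.BirchSwinnertonDyer.Theorems.SchneiderFreeAdditiveX3

open NumberField IsDedekindDomain Field WeierstrassCurve
  Literature.NumberTheory.EllipticCurves Literature.NumberTheory.EllipticCurves.GreenbergSelmer
  Literature.NumberTheory.GaloisRepresentations
  Summit.BirchSwinnertonDyer.Rank1Residual.X2.GreenbergVatsalTateDatum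
  Summit.BirchSwinnertonDyer.Rank1Residual.X2.GreenbergVatsalTateDatumSign
  Summit.BirchSwinnertonDyer.Rank1Residual.X2.GreenbergVatsalTateDatumCofree
  Summit.BirchSwinnertonDyer.Rank1Residual.X2.GreenbergVatsalReductionDatum

set_option linter.dupNamespace false

variable {K : Type} [Field K] [NumberField K] (W : WeierstrassCurve K) (p : ℕ) [hp : Fact p.Prime]
  {v : HeightOneSpectrum (𝓞 K)}
  (Ψ : Additive (AlgebraicClosure (v.adicCompletion K))ˣ →+ localPoints W (v.adicCompletion K))
  (t : AlgebraicClosure (v.adicCompletion K))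
  (hΨσ : ∀ (σ : absoluteGaloisGroup (v.adicCompletion K))
      (u : (AlgebraicClosure (v.adicCompletion K))ˣ),
    σ • Ψ (Additive.ofMul u) =
      (if Field.absoluteGaloisGroup.toAlgEquiv (v.adicCompletion K) σ t = t then (1 : ℤ)
        else -1) •
      Ψ (Additive.ofMul (Units.map
        (Field.absoluteGaloisGroup.toAlgEquiv (v.adicCompletion K) σ :
          AlgebraicClosure (v.adicCompletion K) →* AlgebraicClosure (v.adicCompletion K)) u)))
  {q : v.adicCompletion K} (hq0 : q ≠ 0) (hq1 : Valued.v q < 1)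
  (hker : ∀ u : (AlgebraicClosure (v.adicCompletion K))ˣ, Ψ (Additive.ofMul u) = 0 →
    ∃ a : ℤ, (u : AlgebraicClosure (v.adicCompletion K)) =
      algebraMap (v.adicCompletion K) (AlgebraicClosure (v.adicCompletion K)) q ^ a)

/-! ## §1. Points of `C[p^k]` are parametrised by `μ_{p^k}` -/

omit hp in
include hq0 hq1 hker in
/-- **A point of the Tate line killed by `p^k` is `Ψ(ζ)` with `ζ^{p^k} = 1`**: if `ι c = Ψ(ζ)` (`ζ` of
finite order) and `p^k c = 0` then `Ψ(ζ^{p^k}) = 0`, so `ζ^{p^k} ∈ q^ℤ` has finite order, hence is `1`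
(`0 < |q|_v < 1`, tree `eq_one_of_isOfFinOrder_of_map_eq_zero`).  GV p. 14: `C ≅ μ_{p^∞}`.
[cite: SilvermanATAEC1994, Ch. V Thm. 3.1 (c),(d)] [cite: GreenbergVatsal2000, §2 p. 14] -/
theorem exists_pow_eq_one_of_mem_tateDatum (c : W.geomPrimaryTorsion p)
    (hc : c ∈ (tateDatum W p Ψ (sign_disj W Ψ t hΨσ)).plus) (k : ℕ) (hpc : p ^ k • c = 0) :
    ∃ ζ : (AlgebraicClosure (v.adicCompletion K))ˣ, ζ ^ p ^ k = 1 ∧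
      Ψ (Additive.ofMul ζ) = pointsMap W (v.adicCompletion K) (c : W.geomPoints) := by
  obtain ⟨ζ, hζfin, hζc⟩ := (mem_tateDatum_plus_iff (sign_disj W Ψ t hΨσ) c).1 hc
  refine ⟨ζ, ?_, hζc⟩
  have h0 : Ψ (Additive.ofMul (ζ ^ p ^ k)) = 0 := by
    rw [ofMul_pow, map_nsmul, hζc, ← map_nsmul, ← AddSubmonoidClass.coe_nsmul, hpc,
      ZeroMemClass.coe_zero, map_zero]
  exact Summit.BirchSwinnertonDyer.Rank1Residual.X2.GreenbergVatsalTateKummerLocal.eq_one_of_isOfFinOrder_of_map_eq_zero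
    W Ψ hker hq0 hq1 (hζfin.pow) h0

/-! ## §2. The character of the Tate line at every level -/

include hq0 hq1 hker in
/-- **The character of the Tate line.**  For EVERY `σ ∈ Γ_{K_v}`, every `k` and every point `c` of the
Tate line with `p^k c = 0`:  `res σ • c = (χ(σ) · n) • c`, where `χ(σ) = ±1` is the sign of the
parametrisation at `σ` (`+1` iff `σ t = t`) and `n = χ_p(σ) mod p^k` is read off the `p`-adic cyclotomic
character of `K_v` (`σ ζ = ζ^n` on `μ_{p^k}`, Mathlib `cyclotomicCharacter.spec`).  GV p. 14: "`C ≅ μ_{p^∞}`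
(twisted by an unramified quadratic character in the non-split case)".
[cite: GreenbergVatsal2000, §2 pp. 14–15] [cite: SilvermanATAEC1994, Ch. V Thm. 3.1 (d), Lemma 5.2 (c)] -/
theorem smul_eq_sign_mul_cyclotomic_smul_of_mem_tateDatum (σ : absoluteGaloisGroup (v.adicCompletion K))
    (k : ℕ) (c : W.geomPrimaryTorsion p) (hc : c ∈ (tateDatum W p Ψ (sign_disj W Ψ t hΨσ)).plus)
    (hpc : p ^ k • c = 0) :
    absGaloisRestrict K (v.adicCompletion K) σ • c =
      ((if Field.absoluteGaloisGroup.toAlgEquiv (v.adicCompletion K) σ t = t then (1 : ℤ) else -1) *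
        ((PadicInt.toZModPow k
          ((GaloisRep.cyclotomicCharacter (v.adicCompletion K) p σ : ℤ_[p]ˣ) : ℤ_[p])).val : ℤ)) • c := by
  haveI : CharZero (v.adicCompletion K) := charZero_adicCompletion v
  haveI : NeZero ((p : ℕ) : v.adicCompletion K) := NeZero.charZero
  obtain ⟨ζ, hζp, hζc⟩ := exists_pow_eq_one_of_mem_tateDatum W p Ψ t hΨσ hq0 hq1 hker c hc k hpc
  set s : ℤ := (if Field.absoluteGaloisGroup.toAlgEquiv (v.adicCompletion K) σ t = t then (1 : ℤ)
    else -1) with hs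
  set n : ℕ := (PadicInt.toZModPow k
    ((GaloisRep.cyclotomicCharacter (v.adicCompletion K) p σ : ℤ_[p]ˣ) : ℤ_[p])).val with hn
  have hζp' : (ζ : AlgebraicClosure (v.adicCompletion K)) ^ p ^ k = 1 := by
    rw [← Units.val_pow_eq_pow_val, hζp, Units.val_one]
  have hσζ : σ • (ζ : AlgebraicClosure (v.adicCompletion K)) = (ζ : _) ^ n :=
    GaloisRep.cyclotomicCharacter_spec (v.adicCompletion K) p σ _ hζp'
  have hunit : Units.map (Field.absoluteGaloisGroup.toAlgEquiv (v.adicCompletion K) σ :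
      AlgebraicClosure (v.adicCompletion K) →* AlgebraicClosure (v.adicCompletion K)) ζ = ζ ^ n := by
    ext
    rw [Units.coe_map, MonoidHom.coe_coe, ← Field.absoluteGaloisGroup.smul_def, hσζ,
      Units.val_pow_eq_pow_val]
  -- compare in `E(K̄_v)` through the injective `ι`
  apply pointsMap_coe_injective W p
  change pointsMap W (v.adicCompletion K)
      (((absGaloisRestrict K (v.adicCompletion K) σ • c : W.geomPrimaryTorsion p)) : W.geomPoints) =
    pointsMap W (v.adicCompletion K) ((((s * (n : ℤ)) • c : W.geomPrimaryTorsion p)) : W.geomPoints)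
  rw [primaryComponent.coe_smul, pointsMap_absGaloisRestrict_smul, ← hζc, hΨσ σ ζ, hunit,
    AddSubgroupClass.coe_zsmul, map_zsmul, ← hζc, ofMul_pow, map_nsmul, mul_smul, natCast_zsmul]

/-! ## §3. The character in the shape of hypothesis (ii) of `stub_finV_*_of_lineCharacter` -/

omit hp in
/-- Arithmetic of the clause: if `N ≡ s · x (mod p^k)` in `ℤ_p` and `n = x mod p^k`, then `N • c = (s n) • c`
for every `c` with `p^k c = 0`. [folklore] -/
theorem zsmul_eq_of_sub_mem_span_pow {M : Type*} [AddCommGroup M] [Fact p.Prime] {k : ℕ} {c : M}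
    (hpc : p ^ k • c = 0) {s N : ℤ} {x : ℤ_[p]}
    (hN : ((N : ℤ_[p]) - (s : ℤ_[p]) * x) ∈ (Ideal.span {(p : ℤ_[p]) ^ k} : Ideal ℤ_[p])) :
    N • c = (s * ((PadicInt.toZModPow k x).val : ℤ)) • c := by
  set n : ℕ := (PadicInt.toZModPow k x).val with hn
  -- `N ≡ s n (mod p^k)` as integers
  have hmod : ((N - s * (n : ℤ) : ℤ) : ZMod (p ^ k)) = 0 := by
    have h1 : PadicInt.toZModPow k ((N : ℤ_[p]) - (s : ℤ_[p]) * x) = 0 := by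
      rw [← RingHom.mem_ker, PadicInt.ker_toZModPow]; exact hN
    rw [map_sub, map_mul, map_intCast, map_intCast] at h1
    have hx : PadicInt.toZModPow k x = ((n : ℕ) : ZMod (p ^ k)) := by
      rw [hn, ZMod.natCast_zmod_val]
    rw [hx] at h1
    push_cast
    exact h1
  obtain ⟨m, hm⟩ := (ZMod.intCast_zmod_eq_zero_iff_dvd _ _).mp hmod
  have hN' : N = s * (n : ℤ) + (p ^ k : ℕ) * m := by
    have : N - s * (n : ℤ) = ((p ^ k : ℕ) : ℤ) * m := hm
    linarith
  have hzero : ((((p ^ k : ℕ) : ℤ)) * m) • c = 0 := by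
    rw [mul_comm, mul_smul, natCast_zsmul, hpc, smul_zero]
  rw [hN', add_zsmul, hzero, add_zero]

include hq0 hq1 hker in
/-- **The Tate line with its character, LOCAL form**: for every `σ ∈ Γ_{K_v}` there is a sign
`s = ±1` (`= σ(t)/t`) such that `res σ • c = N • c` for every `c ∈ C` with `p^k c = 0` and every
integer `N ≡ s · χ_p(σ) (mod p^k)`, `χ_p` the cyclotomic character of `K_v`.
[cite: GreenbergVatsal2000, §2 pp. 14–15] [cite: SilvermanATAEC1994, Ch. V Thm. 3.1 (d), Lemma 5.2 (c)] -/
theorem tateDatum_lineCharacter_local (σ : absoluteGaloisGroup (v.adicCompletion K)) :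
    ∃ s : ℤ, (s = 1 ∨ s = -1) ∧
      ∀ (k : ℕ) (c : W.geomPrimaryTorsion p), c ∈ (tateDatum W p Ψ (sign_disj W Ψ t hΨσ)).plus →
        p ^ k • c = 0 → ∀ N : ℤ,
          ((N : ℤ_[p]) - (s : ℤ_[p]) *
              ((GaloisRep.cyclotomicCharacter (v.adicCompletion K) p σ : ℤ_[p]ˣ) : ℤ_[p])) ∈
            (Ideal.span {(p : ℤ_[p]) ^ k} : Ideal ℤ_[p]) →
          absGaloisRestrict K (v.adicCompletion K) σ • c = N • c := by
  refine ⟨if Field.absoluteGaloisGroup.toAlgEquiv (v.adicCompletion K) σ t = t then (1 : ℤ) else -1,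
    by split_ifs <;> simp, fun k c hc hpc N hN ↦ ?_⟩
  rw [zsmul_eq_of_sub_mem_span_pow p hpc hN]
  exact smul_eq_sign_mul_cyclotomic_smul_of_mem_tateDatum W p Ψ t hΨσ hq0 hq1 hker σ k c hc hpc

include hq0 hq1 hker in
/-- **The Tate line with its character, GLOBAL form** (the character of `K` at `res σ`, as in
hypothesis (ii) of `stub_finV_potMult_of_lineCharacter`): for every `σ ∈ Γ_{K_v}` there is `s = ±1` with
`res σ • c = N • c` whenever `c ∈ C`, `p^k c = 0` and `N ≡ s · χ_p(res σ) (mod p^k)` — the cyclotomic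
character is compatible with restriction (`cyclotomicCharacter_absGaloisRestrict`).
[cite: GreenbergVatsal2000, §2 pp. 14–15] [cite: SerreAbelianLadic1968, Ch. I §1.2] -/
theorem tateDatum_lineCharacter (σ : absoluteGaloisGroup (v.adicCompletion K)) :
    ∃ s : ℤ, (s = 1 ∨ s = -1) ∧
      ∀ (k : ℕ) (c : W.geomPrimaryTorsion p), c ∈ (tateDatum W p Ψ (sign_disj W Ψ t hΨσ)).plus →
        p ^ k • c = 0 → ∀ N : ℤ,
          ((N : ℤ_[p]) - (s : ℤ_[p]) *
              ((GaloisRep.cyclotomicCharacter K p (absGaloisRestrict K (v.adicCompletion K) σ) :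
                ℤ_[p]ˣ) : ℤ_[p])) ∈ (Ideal.span {(p : ℤ_[p]) ^ k} : Ideal ℤ_[p]) →
          absGaloisRestrict K (v.adicCompletion K) σ • c = N • c := by
  haveI : NeZero ((p : ℕ) : K) := NeZero.charZero
  rw [cyclotomicCharacter_absGaloisRestrict K (v.adicCompletion K) p σ]
  exact tateDatum_lineCharacter_local W p Ψ t hΨσ hq0 hq1 hker σ

/-! ## §4. The Tate line is non-zero and proper -/

omit [NumberField K] hp in
/-- `{c ∈ C | p c = 0}` is the carrier of `C ⊓ E[p^∞][p]`. [folklore] -/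
theorem ncard_sep_eq_natCard_inf_torsionBy [Fact p.Prime] (C : AddSubgroup (W.geomPrimaryTorsion p)) :
    Set.ncard {c : W.geomPrimaryTorsion p | c ∈ C ∧ p • c = 0} =
      Nat.card ↥(C ⊓ AddSubgroup.torsionBy (↥(W.geomPrimaryTorsion p)) (p : ℤ)) := by
  rw [← Nat.card_coe_set_eq]
  have hset : {c : W.geomPrimaryTorsion p | c ∈ C ∧ p • c = 0} =
      ((C ⊓ AddSubgroup.torsionBy (↥(W.geomPrimaryTorsion p)) (p : ℤ) : AddSubgroup _) : Set _) := by
    ext c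
    rw [Set.mem_setOf_eq, SetLike.mem_coe, AddSubgroup.mem_inf, AddSubgroup.torsionBy,
      Submodule.mem_toAddSubgroup, Submodule.mem_torsionBy_iff]
    change _ ↔ c ∈ C ∧ (p : ℤ) • c = 0
    rw [natCast_zsmul]
  rw [hset]
  rfl

include hq0 hq1 hker in
/-- **The Tate line is non-zero**: `#C[p] = p > 1`. [cite: GreenbergVatsal2000, §2 p. 14] -/
theorem tateDatum_plus_ne_bot [W.IsElliptic] : (tateDatum W p Ψ (sign_disj W Ψ t hΨσ)).plus ≠ ⊥ := by
  intro hbot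
  have h := natCard_tateDatum_plus_inf_torsionBy W p Ψ (sign_disj W Ψ t hΨσ) hq0 hq1 hker
  rw [hbot, bot_inf_eq, AddSubgroup.card_bot] at h
  exact hp.out.one_lt.ne h

include hq0 hq1 hker in
/-- **The Tate line is proper**: `#C[p] = p` while `#E[p] = p²` (Silverman III.6.4; door-c5's
`ncard_geomPrimaryTorsion_pTorsion_eq_sq`). [cite: GreenbergVatsal2000, §2 p. 14]
[cite: SilvermanAEC2009, Cor. III.6.4(b)] -/
theorem tateDatum_plus_ne_top [W.IsElliptic] : (tateDatum W p Ψ (sign_disj W Ψ t hΨσ)).plus ≠ ⊤ := by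
  intro htop
  have h := natCard_tateDatum_plus_inf_torsionBy W p Ψ (sign_disj W Ψ t hΨσ) hq0 hq1 hker
  rw [← ncard_sep_eq_natCard_inf_torsionBy W p, htop] at h
  have hsq := ncard_geomPrimaryTorsion_pTorsion_eq_sq W (p := p)
  have hset : {c : W.geomPrimaryTorsion p | c ∈ (⊤ : AddSubgroup _) ∧ p • c = 0} =
      {m : W.geomPrimaryTorsion p | p • m = 0} := by
    ext c; simp
  rw [hset, hsq] at h
  have h1 : p ^ 1 < p ^ 2 := Nat.pow_lt_pow_right hp.out.one_lt one_lt_two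
  rw [pow_one] at h1
  exact h1.ne' h

include hq0 hq1 hker in
/-- **The numeric clauses of the Tate line**: `#C[p] ≤ p` and points of every order `p^k` (door-c5's
`lineClauses_of_divisible` on the divisible, proper, non-zero Tate line).
[cite: GreenbergVatsal2000, §2 p. 14] [cite: CoatesLNM1716, p. 31 (62)] -/
theorem tateDatum_lineClauses [W.IsElliptic] :
    Set.ncard {c : W.geomPrimaryTorsion p | c ∈ (tateDatum W p Ψ (sign_disj W Ψ t hΨσ)).plus ∧
        p • c = 0} ≤ p ∧
      ∀ k : ℕ, ∃ c ∈ (tateDatum W p Ψ (sign_disj W Ψ t hΨσ)).plus, addOrderOf c = p ^ k := by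
  have hdiv := tateDatum_plus_divisible W p Ψ (sign_disj W Ψ t hΨσ)
  have htop := tateDatum_plus_ne_top W p Ψ t hΨσ hq0 hq1 hker
  have hbot := tateDatum_plus_ne_bot W p Ψ t hΨσ hq0 hq1 hker
  exact W.lineClauses_of_divisible _ hdiv htop hbot

end Summit.BirchSwinnertonDyer.BirchSwinnertonDyer.Theorems.SchneiderFreeAdditiveX3

end
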